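import Summits.ValiantsHypothesis.ValiantsHypothesis.Theorems.GrenetZeonDualUnipotentThreeHalvesLongMassNilSpaceTopImage
import Summits.ValiantsHypothesis.ValiantsHypothesis.Theorems.GrenetZeonDualUnipotentThreeHalvesLongMassMixedWords

/-!
# `GrenetZeon.DualUnipotentThreeHalves` (stmt-ValiantsHypothesis-24318), line `slow_core`, stub (c) `SlowCore.LongMassSlowLawInv`:
# the top span absorbs EVERY polarisation of the top power (all-order form of de Seguins Pazzis' Prop. 2.2)

✓ `NilSpaceTopImage.derivSum_mulVec_mem` (dSP 2019 Prop. 2.2) extracts the FIRST-order coefficient of the vector polynomial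
`t ↦ (A + tB)^{H−1} y`, all of whose values are top images.  Since a vector polynomial with all values in a subspace `K` has ALL its
coefficients in `K` (`coeff_mem_of_forall_eval_mem`, functional separation + a polynomial with infinitely many roots vanishes), and the
`t^q`-coefficient of `(A + tB)^{H−1}` is the mixed word sum `Σ_{|ε| = q} word_ε(A,B)` (✓ `LongMassMixedWords.add_smul_pow_eq_sum_words`), we get:

* ★ `coeff_mem_of_forall_eval_mem` — if `Σ_{q ≤ d} t^q · c_q ∈ K` for every `t ∈ ℂ` then every `c_q ∈ K` (reusable brick);
* ★★ `wordSum_mulVec_mem` — ALL-ORDER TOP-SPAN LAW: in a nilpotent space `V` of uniform index `≤ H`, for every `K` containing all top images,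
  all `A, B ∈ V`, `y` and every `q`: `(Σ_{ε : Fin (H−1) → Bool, |ε| = q} word_ε(A,B)) · y ∈ K` — the top span `K(V)` absorbs every
  polarisation of the top power map `X ↦ X^{H−1}`.

HONEST FRAMING.  Support lemmas (`--supports stmt-ValiantsHypothesis-24318`); NOT progress on (c) (RESEARCH — OPEN); closes no stub; S3, 24318,
8062, `VP ≠ VNP` NOT proved.  Def-free, no named facts, no sorry.
[cite: deSeguinsPazzis2019StructuredGerstenhaberII, Prop. 2.2]
-/

set_option linter.dupNamespace false
set_option autoImplicit false

noncomputable section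

namespace Summit.ValiantsHypothesis.ValiantsHypothesis.Theorems.GrenetZeon.NilSpaceTopImage

open Matrix
open scoped BigOperators
open Summit.ValiantsHypothesis.ValiantsHypothesis.Theorems.GrenetZeon.LongMassHomogenise (add_smul_pow_eq_sum_words)

variable {b : ℕ}

/-- ★ **ALL COEFFICIENTS OF A VECTOR POLYNOMIAL WITH VALUES IN `K` LIE IN `K`.**  If `Σ_{q < d} t^q · c_q ∈ K` for every `t ∈ ℂ`, then
`c_q ∈ K` for every `q < d`. -/
theorem coeff_mem_of_forall_eval_mem (K : Submodule ℂ (Fin b → ℂ)) (c : ℕ → Fin b → ℂ) (d : ℕ)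
    (h : ∀ t : ℂ, (∑ q ∈ Finset.range d, t ^ q • c q) ∈ K) : ∀ q, q < d → c q ∈ K := by
  classical
  intro q hq
  rw [← Subspace.forall_mem_dualAnnihilator_apply_eq_zero_iff]
  intro φ hφ
  rw [Submodule.mem_dualAnnihilator] at hφ
  set f : Polynomial ℂ := ∑ q' ∈ Finset.range d, Polynomial.monomial q' (φ (c q')) with hf
  have hf0 : f = 0 := by
    apply Polynomial.funext
    intro t
    rw [Polynomial.eval_zero, hf, Polynomial.eval_finsetSum]
    simp only [Polynomial.eval_monomial]
    have e : ∑ q' ∈ Finset.range d, φ (c q') * t ^ q' = φ (∑ q' ∈ Finset.range d, t ^ q' • c q') := by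
      rw [map_sum]
      exact Finset.sum_congr rfl fun q' _ => by rw [map_smul, smul_eq_mul, mul_comm]
    rw [e]
    exact hφ _ (h t)
  have hc : f.coeff q = φ (c q) := by
    rw [hf, Polynomial.finsetSum_coeff, Finset.sum_eq_single q]
    · exact Polynomial.coeff_monomial_same q _
    · intro q' _ hne
      exact Polynomial.coeff_monomial_of_ne _ (Ne.symm hne)
    · intro hq'
      exact absurd (Finset.mem_range.mpr hq) hq'
  rw [← hc, hf0, Polynomial.coeff_zero]

/-- The power of a line applied to a vector, grouped by `t`-degree: `(A + tB)^p y = Σ_{q ≤ p} t^q · (Σ_{|ε| = q} word_ε(A,B)) y`. -/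
theorem add_smul_pow_mulVec_eq_sum (A B : Matrix (Fin b) (Fin b) ℂ) (t : ℂ) (p : ℕ) (y : Fin b → ℂ) :
    (A + t • B) ^ p *ᵥ y = ∑ q ∈ Finset.range (p + 1), t ^ q •
      ((∑ ε ∈ (Finset.univ : Finset (Fin p → Bool)).filter (fun ε => (∑ i, if ε i then 1 else 0) = q),
        (List.ofFn fun i => if ε i then B else A).prod) *ᵥ y) := by
  classical
  rw [add_smul_pow_eq_sum_words, Matrix.sum_mulVec]
  have hmaps : ∀ ε ∈ (Finset.univ : Finset (Fin p → Bool)), (∑ i, if ε i then 1 else 0) ∈ Finset.range (p + 1) := by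
    intro ε _
    rw [Finset.mem_range, Nat.lt_succ_iff]
    calc (∑ i, if ε i then 1 else 0) ≤ ∑ _i : Fin p, 1 := Finset.sum_le_sum fun i _ => by split_ifs <;> omega
      _ = p := by simp
  rw [← Finset.sum_fiberwise_of_maps_to hmaps]
  refine Finset.sum_congr rfl fun q _ => ?_
  rw [Matrix.sum_mulVec, Finset.smul_sum]
  refine Finset.sum_congr rfl fun ε hε => ?_
  rw [(Finset.mem_filter.mp hε).2, Matrix.smul_mulVec]

/-- ★★ **ALL-ORDER TOP-SPAN LAW.**  In a nilpotent space `V` of uniform index `≤ H`, for every subspace `K` containing all top images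
`X^{H−1} y` (`X ∈ V`), all `A, B ∈ V`, `y` and every `q`: the `q`-th polarisation `(Σ_{|ε| = q} word_ε(A,B))·y` of the top power lies in `K`.
[cite: deSeguinsPazzis2019StructuredGerstenhaberII, Prop. 2.2] -/
theorem wordSum_mulVec_mem (V : Submodule ℂ (Matrix (Fin b) (Fin b) ℂ)) {H : ℕ}
    (K : Submodule ℂ (Fin b → ℂ)) (hK : ∀ X ∈ V, ∀ y : Fin b → ℂ, X ^ (H - 1) *ᵥ y ∈ K)
    {A B : Matrix (Fin b) (Fin b) ℂ} (hA : A ∈ V) (hB : B ∈ V) (y : Fin b → ℂ) (q : ℕ) :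
    (∑ ε ∈ (Finset.univ : Finset (Fin (H - 1) → Bool)).filter (fun ε => (∑ i, if ε i then 1 else 0) = q),
        (List.ofFn fun i => if ε i then B else A).prod) *ᵥ y ∈ K := by
  classical
  by_cases hq : q < H - 1 + 1
  · refine coeff_mem_of_forall_eval_mem K (fun q => (∑ ε ∈ (Finset.univ : Finset (Fin (H - 1) → Bool)).filter
      (fun ε => (∑ i, if ε i then 1 else 0) = q), (List.ofFn fun i => if ε i then B else A).prod) *ᵥ y) (H - 1 + 1)
      (fun t => ?_) q hq
    rw [← add_smul_pow_mulVec_eq_sum]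
    exact hK _ (V.add_mem hA (V.smul_mem t hB)) y
  · -- no word of length `H − 1` has more than `H − 1` letters `B`: the sum is empty
    have hempty : (Finset.univ : Finset (Fin (H - 1) → Bool)).filter (fun ε => (∑ i, if ε i then 1 else 0) = q) = ∅ := by
      refine Finset.filter_eq_empty_iff.mpr fun ε _ hεq => hq ?_
      rw [← hεq, Nat.lt_succ_iff]
      calc (∑ i, if ε i then 1 else 0) ≤ ∑ _i : Fin (H - 1), 1 := Finset.sum_le_sum fun i _ => by split_ifs <;> omega
        _ = H - 1 := by simp
    rw [hempty, Finset.sum_empty, Matrix.zero_mulVec]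
    exact K.zero_mem

end Summit.ValiantsHypothesis.ValiantsHypothesis.Theorems.GrenetZeon.NilSpaceTopImage

end
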